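import Literature.Computability.QuantumComplexity.ForrelationThm25EncodeFP
import Literature.Computability.Complexity.ListFoldBricks
import Literature.Computability.Complexity.FPStringBricks
import HarnessLib

/-!
# Aaronson–Ambainis Theorem 25 (discharge): QSIM over `{H, CCSIGN}` `≤ₚ` explicit `k`-fold FORRELATION

Topic `Literature/Computability/QuantumComplexity`; sibling of `ForrelationCompleteProofs.lean`,
whose named fact `AaronsonAmbainis2018_thm25` — QSIM (S. Aaronson, A. Ambainis, *Forrelation*,
SIAM J. Comput. 47 (2018) = arXiv:1411.5729, §6, p. 26: an `n`-qubit circuit `Q` over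
`{H, CCSIGN}`, `A_Q = ⟨0ⁿ|Q|0ⁿ⟩ ≥ 3/5` versus `|A_Q| ≤ 1/100`; instances coded with `n` in binary,
`QSimInstance.encode`) Karp-reduces in polynomial time to explicit `k`-fold FORRELATION
(`kForrelationProblem`) — is Theorem 25 of the paper (p. 27). The reduction itself (gadget,
parity repair, instance map, its polynomial-time machine) is discharged in the tree over the
*sign basis* `{H, Z, CZ, CCZ}` with `n` written in unary (`qSimSignProblem`, `QSimSign.lean`;
`AaronsonAmbainis2018_thm25_sign_holds`, `ForrelationThm25EncodeFP.lean`). This file closes the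
remaining gap, a polynomial-time Karp reduction

  `qSimProblem ≤ₚ qSimSignProblem`,

and concludes `AaronsonAmbainis2018_thm25_holds` by transitivity of Karp reductions of promise
problems (`PolyTimeReducible.trans_holds`, Goldreich 2006, Def. 1.4).

## The reduction

Because the code of a QSIM instance writes `n` in binary while `qSimSignProblem` writes it in
unary, the wires must be renumbered into a range polynomial in the length of the code (the
"discard the untouched wires" step of `ForrelationThm25Instance.lean`, `compress`). Let `W` be the
list of all wire indices of the gate list, in order of occurrence and with multiplicity
(`allWireVals`), `T = |W| ≤ 3m`, and `ψ(v) = #{u ∈ W : u < v}` (`psi`). On the wires that occur,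
`ψ` is strictly increasing with values `< T`, so `(n, Q) ↦ (T, Q')`, `Q'` the circuit `Q` with
every wire `v` renamed `ψ(v)` and the symbols `H ↦ H`, `CCSIGN ↦ CCZ` (`toSign (renumber Q)`),
preserves `A_Q` (`signAmplitude_toSign`, `transitionAmplitude_renumber`: the renumbered circuit is
the compressed circuit transported along a wire embedding, `transitionAmplitude_mapWires`) and
oracle-freeness, hence yes- and no-instances (same thresholds).

On codes the map is assembled in the tree's algebra of `FP` string functions — no machine is
programmed: folds over coded lists (`Brick.foldFn`, `ListFoldBricks.lean`), records and
projections (`BrickAlgebra.lean`), comparison and successor of binary numerals (`Brick.ltFn`,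
`Brick.addFn`), branching (`iteFn`), fan-out, `List.tail`, `List.cons`, constants, composition
(`comp_mem_FP`): `redFn` with `redFn_mem_FP` and **`redFn_encode`**
(`redFn (code (n, Q)) = code (T, toSign (renumber Q))` for oracle-free `Q`).

## Main results

* `qSimProblem_reducible_qSimSignProblem : qSimProblem ≤ₚ qSimSignProblem`;
* `AaronsonAmbainis2018_thm25_holds : AaronsonAmbainis2018_thm25` (discharge);
* `aaronson_ambainis_kForrelation_complete_of_mem_of_lemma24`: the completeness fact from the two
  remaining named facts (membership; Lemma 24, hardness of QSIM over `{H, CCSIGN}`).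

## References

* S. Aaronson, A. Ambainis, *Forrelation: a problem that optimally separates quantum from
  classical computing*, SIAM J. Comput. 47 (2018) 982–1038; arXiv:1411.5729, §6: p. 26 (QSIM,
  `A_Q`, Lemma 24), p. 27 (Thm. 25 and its proof).
* O. Goldreich, *On promise problems: a survey*, 2006, Def. 1.4 (Karp reductions of promise
  problems; transitivity).
* S. Arora, B. Barak, *Computational Complexity: A Modern Approach*, CUP 2009, §0.1 (codes of
  pairs and lists), §1.3 (polynomial time is closed under composition and bounded loops).
-/

noncomputable section

namespace Literature.Computability.QuantumComplexity

open _root_.Computability Complexity Cryptography Brick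

namespace Thm25Red

variable {n N : ℕ}

/-! ### Small list lemmas -/

/-- The coded list of a `flatMap` is the concatenation of the coded pieces (`encList` is a monoid
morphism; cf. the twin `FregeTransl.encList_append` of `MetaComplexity/FregeTranslation.lean`, not
importable here). [folklore] -/
theorem encList_flatMap {α : Type*} (f : α → List (List Bool)) (l : List α) :
    encList (l.flatMap f) = (l.map fun a => encList (f a)).flatten := by
  induction l with
  | nil => rfl
  | cons a l ih =>
    rw [List.flatMap_cons, List.map_cons, List.flatten_cons, ← ih]
    generalize l.flatMap f = r
    induction f a with
    | nil => rfl
    | cons b m ihm => rw [List.cons_append, encList_cons, encList_cons, ihm]; simp [boolPair]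

/-- Left fold of "append a piece". [folklore] -/
theorem foldl_append_eq {α : Type*} (f : α → List Bool) : ∀ (l : List α) (acc : List Bool),
    l.foldl (fun acc a => acc ++ f a) acc = acc ++ (l.map f).flatten
  | [], acc => by simp
  | a :: l, acc => by
    rw [List.foldl_cons, foldl_append_eq f l, List.map_cons, List.flatten_cons, List.append_assoc]

/-- Left fold of "append the coded item": the code of the mapped list. [folklore] -/
theorem foldl_append_boolPair_eq {α : Type*} (f : α → List Bool) : ∀ (l : List α) (acc : List Bool),
    l.foldl (fun acc a => acc ++ boolPair (f a) []) acc = acc ++ encList (l.map f)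
  | [], acc => by simp
  | a :: l, acc => by
    rw [List.foldl_cons, foldl_append_boolPair_eq f l, List.map_cons, encList_cons, List.append_assoc]
    simp [boolPair]

/-- Left fold of "append a `1`": a unary tally of the items. [folklore] -/
theorem foldl_append_true_eq {α : Type*} : ∀ (l : List α) (acc : List Bool),
    l.foldl (fun acc _ => acc ++ [true]) acc = acc ++ List.replicate l.length true
  | [], acc => by simp
  | a :: l, acc => by
    rw [List.foldl_cons, foldl_append_true_eq l, List.length_cons, List.replicate_succ, List.append_assoc]
    rfl

/-- The circuit encoder is the coded list of the gate codes. [folklore] -/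
theorem encode_eq_encList {G : QGateSet} [Encodable G.Op] (C : QCircuit G n) :
    C.encode = encList (C.gates.map QGate.encode) := by
  unfold QCircuit.encode
  induction C.gates with
  | nil => rfl
  | cons g gs ih => rw [List.foldr_cons, ih, List.map_cons, encList_cons]

/-- The code of a list of numbers, spelled with `encList`. [cite: AroraBarak2009, §0.1] -/
def listNatCode (l : List ℕ) : List Bool :=
  boolPair (unaryEncodeNat l.length) (encList (l.map encodeNat))

/-- `encodingListNatBool.encode = listNatCode`. [folklore] -/
theorem encodingListNatBool_encode (l : List ℕ) : encodingListNatBool.encode l = listNatCode l := by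
  have h : ∀ l : List ℕ, l.foldr (fun a acc => boolPair (encodingNatBool.encode a) acc) [] = encList (l.map encodeNat) := by
    intro l
    induction l with
    | nil => rfl
    | cons a l ih => rw [List.foldr_cons, ih, List.map_cons, encList_cons]; rfl
  change boolPair (unaryEncodeNat l.length) (l.foldr (fun a acc => boolPair (encodingNatBool.encode a) acc) []) = _
  rw [h]
  rfl

/-! ### The string functions -/

/-- The wire-list field of a gate code `c = tag :: ⟨sym, ⟨1ʳ, wires⟩⟩`: `sndF (sndF (tail c))`. [folklore] -/
def wiresOfCode : List Bool → List Bool := sndPow 1 ∘ List.tail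

/-- `wiresOfCode ∈ FP`. [folklore] -/
theorem wiresOfCode_mem_FP : wiresOfCode ∈ FP := comp_mem_FP (sndPow_mem_FP 1) PRelSigma.tail_mem_FP

/-- `wiresOfCode` does not lengthen. [folklore] -/
theorem length_wiresOfCode_le (c : List Bool) : (wiresOfCode c).length ≤ c.length :=
  (length_sndPow_le 1 _).trans (by simp)

/-- Step of the all-wires fold: append the wire-list field of the item. [folklore] -/
def allWiresStep : List Bool → List Bool := fun z => sndPow 1 z ++ wiresOfCode (nthF 1 z)

/-- `allWiresStep ∈ FP`. [folklore] -/
theorem allWiresStep_mem_FP : allWiresStep ∈ FP := by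
  show (fun z => sndPow 1 z ++ (wiresOfCode ∘ nthF 1) z) ∈ FP
  exact append_mem_FP (sndPow_mem_FP 1) (comp_mem_FP wiresOfCode_mem_FP (nthF_mem_FP 1))

/-- `allWiresStep` on a step record. [folklore] -/
@[simp] theorem allWiresStep_apply (u a acc : List Bool) :
    allWiresStep (boolPair u (boolPair a acc)) = acc ++ wiresOfCode a := by
  simp [allWiresStep]

/-- **The list of all wire numerals** of the gate codes of the input, in order of occurrence:
`⟨x, encList [c₁, …, c_m]⟩ ↦ wires(c₁) ++ ⋯ ++ wires(c_m)`. [folklore] -/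
def allWiresFn : List Bool → List Bool := foldFn allWiresStep (fun _ => [])

/-- `allWiresFn ∈ FP`. [cite: AroraBarak2009, §1.3] -/
theorem allWiresFn_mem_FP : allWiresFn ∈ FP :=
  foldFn_mem_FP allWiresStep_mem_FP (const_mem_FP _) (c := 0) fun v => by
    have h1 := length_wiresOfCode_le (nthF 1 v)
    have h2 : (nthF 1 v).length = (fstF (sndF v)).length := rfl
    have h3 : (sndPow 1 v).length = (sndF (sndF v)).length := rfl
    simp only [allWiresStep, List.length_append]
    omega

/-- Value of `allWiresFn` on a pair. [folklore] -/
theorem allWiresFn_boolPair (x L : List Bool) :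
    allWiresFn (boolPair x L) = ((decNil L).map wiresOfCode).flatten := by
  rw [allWiresFn, foldFn_boolPair]
  simp only [allWiresStep_apply]
  rw [foldl_append_eq, List.nil_append]

/-- Step of the tally fold: append a `1`. [folklore] -/
def countStep : List Bool → List Bool := fun z => sndPow 1 z ++ [true]

/-- `countStep ∈ FP`. [folklore] -/
theorem countStep_mem_FP : countStep ∈ FP := append_mem_FP (sndPow_mem_FP 1) (const_mem_FP _)

/-- **The unary tally of the items of a coded list**: `⟨x, L⟩ ↦ 1^{#items of L}`. [folklore] -/
def countFn : List Bool → List Bool := foldFn countStep (fun _ => [])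

/-- `countFn ∈ FP`. [cite: AroraBarak2009, §1.3] -/
theorem countFn_mem_FP : countFn ∈ FP :=
  foldFn_mem_FP countStep_mem_FP (const_mem_FP _) (c := 1) fun v => by
    have h3 : sndPow 1 v = sndF (sndF v) := rfl
    simp only [countStep, List.length_append, List.length_singleton, h3]
    omega

/-- Value of `countFn` on a pair. [folklore] -/
theorem countFn_boolPair (x L : List Bool) :
    countFn (boolPair x L) = List.replicate (decNil L).length true := by
  rw [countFn, foldFn_boolPair]
  have h : ∀ acc a : List Bool, countStep (boolPair (boolPair x L) (boolPair a acc)) = acc ++ [true] := fun acc a => by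
    simp [countStep]
  simp only [h]
  rw [foldl_append_true_eq, List.nil_append]

/-- The test of the counting fold on a step record `⟨⟨v, X⟩, ⟨b, acc⟩⟩`: `[⟦b⟧ < ⟦v⟧]`. [folklore] -/
def psiCond : List Bool → List Bool := ltFn ∘ fanoutFn (nthF 1) (fstF ∘ nthF 0)

/-- The successor of the accumulator: `encodeNat (⟦acc⟧ + 1)`. [folklore] -/
def succAcc : List Bool → List Bool := addFn ∘ fanoutFn (sndPow 1) (fun _ => [true])

/-- Step of the counting fold: bump the accumulator if the item is below `v`. [folklore] -/
def psiStep : List Bool → List Bool := iteFn psiCond succAcc (sndPow 1)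

/-- `psiStep ∈ FP`. [folklore] -/
theorem psiStep_mem_FP : psiStep ∈ FP :=
  iteFn_mem_FP (comp_mem_FP ltFn_mem_FP (fanoutFn_mem_FP (nthF_mem_FP 1) (comp_mem_FP fstF_mem_FP (nthF_mem_FP 0))))
    (comp_mem_FP addFn_mem_FP (fanoutFn_mem_FP (sndPow_mem_FP 1) (const_mem_FP _))) (sndPow_mem_FP 1)

/-- `psiCond` is one-bit. [folklore] -/
theorem oneBit_psiCond : OneBit psiCond := oneBit_ltFn.comp _

/-- `psiStep` on every input: an honest branch. [folklore] -/
theorem psiStep_eq (z : List Bool) :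
    psiStep z = if bitsToNat (nthF 1 z) < bitsToNat (fstF (fstF z)) then encodeNat (bitsToNat (sndPow 1 z) + 1)
      else sndPow 1 z := by
  rw [psiStep, iteFn_of_oneBit oneBit_psiCond]
  have hc : psiCond z = [decide (bitsToNat (nthF 1 z) < bitsToNat (fstF (fstF z)))] := by simp [psiCond]
  rw [hc]
  by_cases h : bitsToNat (nthF 1 z) < bitsToNat (fstF (fstF z))
  · rw [if_pos (by simp [h]), if_pos h]; simp [succAcc]
  · rw [if_neg (by simp [h]), if_neg h]

/-- `psiStep` on a step record. [folklore] -/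
theorem psiStep_apply (u b acc : List Bool) :
    psiStep (boolPair u (boolPair b acc)) =
      if bitsToNat b < bitsToNat (fstF u) then encodeNat (bitsToNat acc + 1) else acc := by
  rw [psiStep_eq]; simp [nthF, sndPow]

/-- **`ψ` on codes**: `⟨v, X⟩ ↦ encodeNat #{items b of X : ⟦b⟧ < ⟦v⟧}` (with multiplicity). [folklore] -/
def psiFn : List Bool → List Bool := foldFn psiStep (fun _ => [])

/-- `psiFn ∈ FP`. [cite: AroraBarak2009, §1.3] -/
theorem psiFn_mem_FP : psiFn ∈ FP :=
  foldFn_mem_FP psiStep_mem_FP (const_mem_FP _) (c := 1) fun v => by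
    have h3 : sndPow 1 v = sndF (sndF v) := rfl
    rw [psiStep_eq, h3]
    split_ifs
    · have h1 := length_encodeNat_succ_le (bitsToNat (sndF (sndF v)))
      have h2 := length_encodeNat_bitsToNat_le (sndF (sndF v))
      omega
    · omega

/-- The counting fold from a canonical numeral. [folklore] -/
theorem foldl_psiStep (u : List Bool) : ∀ (l : List (List Bool)) (k : ℕ),
    l.foldl (fun acc b => psiStep (boolPair u (boolPair b acc))) (encodeNat k) =
      encodeNat (k + l.countP fun b => decide (bitsToNat b < bitsToNat (fstF u)))
  | [], k => by simp
  | b :: l, k => by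
    rw [List.foldl_cons, psiStep_apply, List.countP_cons]
    by_cases h : bitsToNat b < bitsToNat (fstF u)
    · rw [if_pos h, bitsToNat_encodeNat, foldl_psiStep u l (k + 1), if_pos (by simp [h])]
      congr 1
      omega
    · rw [if_neg h, foldl_psiStep u l k, if_neg (by simp [h])]
      rfl

/-- **Value of `psiFn` on every pair.** [folklore] -/
theorem psiFn_boolPair (a X : List Bool) :
    psiFn (boolPair a X) = encodeNat ((decNil X).countP fun b => decide (bitsToNat b < bitsToNat a)) := by
  have h := foldl_psiStep (boolPair a X) (decNil X) 0
  rw [fstF_boolPair, Nat.zero_add] at h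
  rw [psiFn, foldFn_boolPair]
  exact h

/-- `ψ`-numerals are short: `|psiFn ⟨a, X⟩| ≤ |X|`. [folklore] -/
theorem length_psiFn_boolPair_le (a X : List Bool) : (psiFn (boolPair a X)).length ≤ X.length := by
  rw [psiFn_boolPair]
  exact (TokConv.length_encodeNat_le _).trans (List.countP_le_length.trans (length_decNil_le X))

/-- The symbol translation on codes: `ε ↦ ε` (`H ↦ H`), anything else `↦ 11` (`CCSIGN ↦ CCZ`,
code `3`). [cite: AaronsonAmbainis2018, §6 (p. 26: "CCSIGN"; p. 27: Thm. 25)] -/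
def symFn : List Bool → List Bool := iteFn isNilFn (fun _ => []) (fun _ => [true, true])

/-- `symFn ∈ FP`. [folklore] -/
theorem symFn_mem_FP : symFn ∈ FP := iteFn_mem_FP isNilFn_mem_FP (const_mem_FP _) (const_mem_FP _)

/-- Value of `symFn`. [folklore] -/
theorem symFn_apply (x : List Bool) : symFn x = if x = [] then [] else [true, true] := by
  rw [symFn, iteFn_of_oneBit oneBit_isNilFn]
  by_cases h : x = [] <;> simp [isNilFn, h]

/-- `|symFn x| ≤ 2`. [folklore] -/
theorem length_symFn_le (x : List Bool) : (symFn x).length ≤ 2 := by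
  rw [symFn_apply]; split_ifs <;> simp

/-- On an argument `⟨W, c⟩`: the untagged gate code `tail c`. [folklore] -/
def tailCode : List Bool → List Bool := List.tail ∘ sndF
/-- On `⟨W, c⟩`: the symbol field of `c`. [folklore] -/
def symOf : List Bool → List Bool := fstF ∘ tailCode
/-- On `⟨W, c⟩`: the (unary) arity field of `c`. [folklore] -/
def arityOf : List Bool → List Bool := nthF 1 ∘ tailCode
/-- On `⟨W, c⟩`: the wire-list field of `c`. [folklore] -/
def wiresOf : List Bool → List Bool := sndPow 1 ∘ tailCode
/-- On `⟨W, c⟩`: the `ψ`-numeral of wire `i` of `c`. [folklore] -/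
def psiAt (i : ℕ) : List Bool → List Bool := psiFn ∘ fanoutFn (nthF i ∘ wiresOf) fstF
/-- On `⟨W, c⟩`: the renumbered wire list of a one-wire gate. [folklore] -/
def oneWire : List Bool → List Bool := fanoutFn (psiAt 0) (fun _ => [])
/-- On `⟨W, c⟩`: the renumbered wire list of a three-wire gate. [folklore] -/
def threeWires : List Bool → List Bool := fanoutFn (psiAt 0) (fanoutFn (psiAt 1) (fanoutFn (psiAt 2) (fun _ => [])))
/-- On `⟨W, c⟩`: the renumbered wire list (one wire for symbol `ε` = `H`, three otherwise). [folklore] -/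
def newWires : List Bool → List Bool := iteFn (isNilFn ∘ symOf) oneWire threeWires

/-- **The new gate code**: `⟨W, 0 :: ⟨s, ⟨1ʳ, wires⟩⟩⟩ ↦ 0 :: ⟨sym s, ⟨1ʳ, ψ(wires)⟩⟩`.
[cite: AaronsonAmbainis2018, §6 Thm. 25] -/
def newGateFn : List Bool → List Bool :=
  List.cons false ∘ fanoutFn (symFn ∘ symOf) (fanoutFn arityOf newWires)

/-- `tailCode ∈ FP`. [folklore] -/
theorem tailCode_mem_FP : tailCode ∈ FP := comp_mem_FP PRelSigma.tail_mem_FP sndF_mem_FP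

/-- `psiAt i ∈ FP`. [folklore] -/
theorem psiAt_mem_FP (i : ℕ) : psiAt i ∈ FP :=
  comp_mem_FP psiFn_mem_FP (fanoutFn_mem_FP (comp_mem_FP (nthF_mem_FP i) (comp_mem_FP (sndPow_mem_FP 1) tailCode_mem_FP))
    fstF_mem_FP)

/-- `newWires ∈ FP`. [folklore] -/
theorem newWires_mem_FP : newWires ∈ FP :=
  iteFn_mem_FP (comp_mem_FP isNilFn_mem_FP (comp_mem_FP fstF_mem_FP tailCode_mem_FP))
    (fanoutFn_mem_FP (psiAt_mem_FP 0) (const_mem_FP _))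
    (fanoutFn_mem_FP (psiAt_mem_FP 0) (fanoutFn_mem_FP (psiAt_mem_FP 1) (fanoutFn_mem_FP (psiAt_mem_FP 2) (const_mem_FP _))))

/-- **`newGateFn ∈ FP`.** [cite: AroraBarak2009, §1.3] -/
theorem newGateFn_mem_FP : newGateFn ∈ FP :=
  comp_mem_FP (cons_mem_FP false) (fanoutFn_mem_FP (comp_mem_FP symFn_mem_FP (comp_mem_FP fstF_mem_FP tailCode_mem_FP))
    (fanoutFn_mem_FP (comp_mem_FP (nthF_mem_FP 1) tailCode_mem_FP) newWires_mem_FP))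

/-- Value of `newWires`. [folklore] -/
theorem newWires_apply (p : List Bool) : newWires p = if symOf p = [] then oneWire p else threeWires p := by
  rw [newWires, iteFn_of_oneBit (oneBit_isNilFn.comp _)]
  by_cases h : symOf p = [] <;> simp [isNilFn, h]

/-- `|newWires ⟨W, c⟩| ≤ 6|W| + 6`. [folklore] -/
theorem length_newWires_le (W c : List Bool) : (newWires (boolPair W c)).length ≤ 6 * W.length + 6 := by
  have h : ∀ i, (psiAt i (boolPair W c)).length ≤ W.length := fun i => by
    simp only [psiAt, Function.comp_apply, fanoutFn_apply, fstF_boolPair]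
    exact length_psiFn_boolPair_le _ _
  have h0 := h 0; have h1 := h 1; have h2 := h 2
  rw [newWires_apply]
  split_ifs
  · simp only [oneWire, fanoutFn_apply, length_boolPair, List.length_nil]; omega
  · simp only [threeWires, fanoutFn_apply, length_boolPair, List.length_nil]; omega

/-- **Size of the new gate code**: `|newGateFn ⟨W, c⟩| ≤ 2|c| + 6|W| + 15`. [folklore] -/
theorem length_newGateFn_le (W c : List Bool) : (newGateFn (boolPair W c)).length ≤ 2 * c.length + 6 * W.length + 15 := by
  have h1 := length_symFn_le (symOf (boolPair W c))
  have h2 : (arityOf (boolPair W c)).length ≤ c.length := by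
    simp only [arityOf, tailCode, Function.comp_apply, sndF_boolPair]
    exact (length_nthF_le 1 _).trans (by simp)
  have h3 := length_newWires_le W c
  simp only [newGateFn, Function.comp_apply, fanoutFn_apply, List.length_cons, length_boolPair]
  omega

/-- Step of the body fold: append the coded new gate code of the item. [folklore] -/
def gateStep : List Bool → List Bool :=
  fun z => sndPow 1 z ++ fanoutFn (newGateFn ∘ fanoutFn (fstF ∘ nthF 0) (nthF 1)) (fun _ => []) z

/-- `gateStep ∈ FP`. [folklore] -/
theorem gateStep_mem_FP : gateStep ∈ FP :=
  append_mem_FP (sndPow_mem_FP 1) (fanoutFn_mem_FP (comp_mem_FP newGateFn_mem_FP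
    (fanoutFn_mem_FP (comp_mem_FP fstF_mem_FP (nthF_mem_FP 0)) (nthF_mem_FP 1))) (const_mem_FP _))

/-- `gateStep` on a step record. [folklore] -/
@[simp] theorem gateStep_apply (u c acc : List Bool) :
    gateStep (boolPair u (boolPair c acc)) = acc ++ boolPair (newGateFn (boolPair (fstF u) c)) [] := by
  simp [gateStep]

/-- **Growth of the body fold** (`FoldGrowth 32`). [folklore] -/
theorem foldGrowth_gateStep : FoldGrowth 32 gateStep := fun v => by
  have h3 : sndPow 1 v = sndF (sndF v) := rfl
  have h4 : nthF 1 v = fstF (sndF v) := rfl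
  have hW := length_fstF_sndF_le (fstF v)
  have hg := length_newGateFn_le (fstF (fstF v)) (fstF (sndF v))
  simp only [gateStep, fanoutFn_apply, Function.comp_apply, nthF_zero, List.length_append, length_boolPair,
    List.length_nil, h3, h4]
  nlinarith

/-- **The new body**: `⟨W, encList [c₁, …, c_m]⟩ ↦ encList [newGate ⟨W, c₁⟩, …, newGate ⟨W, c_m⟩]`. [folklore] -/
def newBodyFn : List Bool → List Bool := foldFn gateStep (fun _ => [])

/-- `newBodyFn ∈ FP`. [cite: AroraBarak2009, §1.3] -/
theorem newBodyFn_mem_FP : newBodyFn ∈ FP := foldFn_mem_FP gateStep_mem_FP (const_mem_FP _) foldGrowth_gateStep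

/-- Value of `newBodyFn` on a pair. [folklore] -/
theorem newBodyFn_boolPair (W L : List Bool) :
    newBodyFn (boolPair W L) = encList ((decNil L).map fun c => newGateFn (boolPair W c)) := by
  rw [newBodyFn, foldFn_boolPair]
  simp only [gateStep_apply, fstF_boolPair]
  rw [foldl_append_boolPair_eq, List.nil_append]

/-- **The reduction on codes**: `w ↦ ⟨1^{T}, newBody ⟨W, sndF w⟩⟩` with `W` the list of all wire
numerals of `w` and `T` its number of items. [cite: AaronsonAmbainis2018, §6 Thm. 25] -/
def redFn : List Bool → List Bool :=
  fanoutFn (countFn ∘ fanoutFn (fun _ => []) allWiresFn) (newBodyFn ∘ fanoutFn allWiresFn sndF)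

/-- **`redFn ∈ FP`.** [cite: AroraBarak2009, §1.3] -/
theorem redFn_mem_FP : redFn ∈ FP :=
  fanoutFn_mem_FP (comp_mem_FP countFn_mem_FP (fanoutFn_mem_FP (const_mem_FP _) allWiresFn_mem_FP))
    (comp_mem_FP newBodyFn_mem_FP (fanoutFn_mem_FP allWiresFn_mem_FP sndF_mem_FP))

/-- Value of `redFn` on a pair. [folklore] -/
theorem redFn_boolPair (x L : List Bool) :
    redFn (boolPair x L) = boolPair (countFn (boolPair [] (allWiresFn (boolPair x L))))
      (newBodyFn (boolPair (allWiresFn (boolPair x L)) L)) := by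
  simp [redFn]

/-! ### The renumbering of the wires -/

/-- The wire indices of a gate, in order. [folklore] -/
def wireVals {G : QGateSet} : QGate G n → List ℕ
  | .gate _ e => List.ofFn fun i => (e i : ℕ)
  | .oracle _ e => List.ofFn fun i => (e i : ℕ)

/-- All wire indices of a gate list, in order of occurrence, with multiplicity. [folklore] -/
def allWireVals {G : QGateSet} (gs : List (QGate G n)) : List ℕ := gs.flatMap wireVals

/-- `ψ(v) = #{u ∈ W : u < v}` (with multiplicity). [folklore] -/
def psi (W : List ℕ) (v : ℕ) : ℕ := W.countP fun u => decide (u < v)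

/-- `ψ` is monotone. [folklore] -/
theorem psi_mono (W : List ℕ) {u v : ℕ} (h : u ≤ v) : psi W u ≤ psi W v :=
  List.countP_mono_left fun x _ hx => by simp only [decide_eq_true_eq] at hx ⊢; omega

/-- `ψ` is strictly increasing on the members of `W`. [folklore] -/
theorem psi_lt_psi {W : List ℕ} {u v : ℕ} (hu : u ∈ W) (huv : u < v) : psi W u < psi W v := by
  obtain ⟨s, t, rfl⟩ := List.append_of_mem hu
  have h1 := psi_mono s huv.le
  have h2 := psi_mono t huv.le
  unfold psi at h1 h2 ⊢
  rw [List.countP_append, List.countP_append, List.countP_cons, List.countP_cons]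
  rw [if_neg (by simp), if_pos (by simp [huv])]
  omega

/-- `ψ(v) < |W|` for `v ∈ W`. [folklore] -/
theorem psi_lt_length {W : List ℕ} {v : ℕ} (hv : v ∈ W) : psi W v < W.length := by
  refine lt_of_le_of_ne List.countP_le_length fun h => ?_
  have := (List.countP_eq_length.1 h) v hv
  simp at this

/-- A wire is touched iff its index occurs. [folklore] -/
theorem mem_touchedWires_iff {G : QGateSet} (gs : List (QGate G n)) (w : Fin n) :
    w ∈ touchedWires gs ↔ (w : ℕ) ∈ allWireVals gs := by
  induction gs with
  | nil => simp [touchedWires, allWireVals]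
  | cons g gs ih =>
    have hg : w ∈ g.wires ↔ (w : ℕ) ∈ wireVals g := by
      rcases g with ⟨op, e⟩ | ⟨k, e⟩ <;>
      · simp only [QGate.wires, Finset.mem_map, Finset.mem_univ, true_and, wireVals, List.mem_ofFn]
        constructor
        · rintro ⟨i, rfl⟩; exact ⟨i, rfl⟩
        · rintro ⟨i, hi⟩; exact ⟨i, Fin.ext hi⟩
    rw [touchedWires, Finset.mem_union, allWireVals, List.flatMap_cons, List.mem_append, hg, ← allWireVals, ih]

/-- **The wire embedding of the renumbering**: the `r`-th touched wire goes to `ψ` of its index.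
[folklore] -/
def kappa {G : QGateSet} (gs : List (QGate G n)) : Fin (touchedWires gs).card ↪ Fin (allWireVals gs).length where
  toFun r := ⟨psi (allWireVals gs) ((touchedWires gs).orderEmbOfFin rfl r),
    psi_lt_length ((mem_touchedWires_iff gs _).1 (Finset.orderEmbOfFin_mem _ _ r))⟩
  inj' := by
    have hmono : StrictMono fun r => psi (allWireVals gs) ((touchedWires gs).orderEmbOfFin rfl r) := by
      intro r r' h
      have h' : ((touchedWires gs).orderEmbOfFin rfl r : ℕ) < (touchedWires gs).orderEmbOfFin rfl r' :=
        ((touchedWires gs).orderEmbOfFin rfl).strictMono h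
      exact psi_lt_psi ((mem_touchedWires_iff gs _).1 (Finset.orderEmbOfFin_mem _ _ r)) h'
    intro r r' h
    exact hmono.injective (congrArg Fin.val h)

/-- Value of `kappa` on a rank. [folklore] -/
theorem kappa_apply_val {G : QGateSet} (gs : List (QGate G n)) (r : Fin (touchedWires gs).card) :
    (kappa gs r : ℕ) = psi (allWireVals gs) ((touchedWires gs).orderEmbOfFin rfl r) := rfl

/-- **The renumbered circuit** on `T = |W|` wires: the compressed circuit transported along
`kappa`, i.e. every wire `v` renamed `ψ(v)`. [cite: AaronsonAmbainis2018, §6 (proof of Thm. 25)] -/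
def renumber (Q : QCircuit hCCSign n) : QCircuit hCCSign (allWireVals Q.gates).length :=
  mapWires (kappa Q.gates) (compress Q)

/-- **Renumbering preserves the transition amplitude.** [cite: AaronsonAmbainis2018, §6 (A_Q)] -/
theorem transitionAmplitude_renumber (Q : QCircuit hCCSign n) :
    transitionAmplitude (renumber Q) = transitionAmplitude Q := by
  rw [renumber, transitionAmplitude_mapWires, transitionAmplitude_compress]

/-- Transport along a wire embedding preserves oracle-freeness. [folklore] -/
theorem isOracleFree_mapWires {G : QGateSet} {n' : ℕ} (ι : Fin n' ↪ Fin n) {C : QCircuit G n'}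
    (hC : C.IsOracleFree) : (mapWires ι C).IsOracleFree := by
  intro g hg
  obtain ⟨g', hg', rfl⟩ := List.mem_map.1 hg
  have := hC g' hg'
  cases g' with
  | gate _ _ => trivial
  | oracle _ _ => exact absurd this id

/-- Renumbering preserves oracle-freeness. [folklore] -/
theorem isOracleFree_renumber {Q : QCircuit hCCSign n} (hQ : Q.IsOracleFree) : (renumber Q).IsOracleFree :=
  isOracleFree_mapWires _ (isOracleFree_compress hQ)

/-! ### From `{H, CCSIGN}` to the sign basis -/

/-- A gate over `{H, CCSIGN}` as a gate over `{H, Z, CZ, CCZ}` (`H ↦ H`, `CCSIGN ↦ CCZ`, same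
wires). [cite: AaronsonAmbainis2018, §6 (p. 26)] -/
def toSignGate : QGate hCCSign N → QGate hSign N
  | .gate HCCSignOp.H e => .gate HSignOp.H (hPlacement e)
  | .gate HCCSignOp.CCSIGN e => .gate HSignOp.CCZ (ccsignPlacement e)
  | .oracle k e => .oracle k e

/-- The translated gate has the same matrix. [cite: AaronsonAmbainis2018, §6 (p. 26)] -/
theorem toMatrix_toSignGate (A : Language Bool) (g : QGate hCCSign N) : (toSignGate g).toMatrix A = g.toMatrix A := by
  rcases g with ⟨_ | _, e⟩ | ⟨k, e⟩ <;> rfl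

/-- A circuit over `{H, CCSIGN}` as a circuit over the sign basis. [cite: AaronsonAmbainis2018, §6 (p. 26)] -/
def toSign (Q : QCircuit hCCSign N) : QCircuit hSign N := ⟨Q.gates.map toSignGate⟩

/-- The translated circuit has the same matrix. [cite: AaronsonAmbainis2018, §6 (p. 26)] -/
theorem toMatrix_toSign (A : Language Bool) (Q : QCircuit hCCSign N) : (toSign Q).toMatrix A = Q.toMatrix A := by
  obtain ⟨gs⟩ := Q
  induction gs with
  | nil => simp [toSign]
  | cons g gs ih =>
    have ih' : (⟨gs.map toSignGate⟩ : QCircuit hSign N).toMatrix A = (⟨gs⟩ : QCircuit hCCSign N).toMatrix A := ih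
    change (⟨toSignGate g :: gs.map toSignGate⟩ : QCircuit hSign N).toMatrix A = _
    rw [QCircuit.toMatrix_cons, ih', toMatrix_toSignGate, QCircuit.toMatrix_cons]

/-- **The translation preserves `A_Q`.** [cite: AaronsonAmbainis2018, §6 (p. 26)] -/
theorem signAmplitude_toSign (Q : QCircuit hCCSign N) : signAmplitude (toSign Q) = transitionAmplitude Q := by
  unfold signAmplitude transitionAmplitude QCircuit.mat
  rw [toMatrix_toSign]

/-- The translation preserves oracle-freeness. [folklore] -/
theorem isOracleFree_toSign {Q : QCircuit hCCSign N} (hQ : Q.IsOracleFree) : (toSign Q).IsOracleFree := by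
  intro g hg
  obtain ⟨g', hg', rfl⟩ := List.mem_map.1 hg
  have := hQ g' hg'
  rcases g' with ⟨_ | _, e⟩ | ⟨k, e⟩
  · trivial
  · trivial
  · exact absurd this id

/-! ### The codes of the new gates -/

/-- The code of the translated symbol: `H ↦ ε` (`= encodeNat 0`), `CCSIGN ↦ 11` (`= encodeNat 3`,
the code of `CCZ`). [folklore] -/
def symCode : HCCSignOp → List Bool
  | .H => []
  | .CCSIGN => [true, true]

/-- The code of the new gate of an (oracle-free) gate. [cite: AaronsonAmbainis2018, §6 Thm. 25] -/
def newCode (W : List ℕ) : QGate hCCSign n → List Bool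
  | .gate op e => false :: boolPair (symCode op) (listNatCode (List.ofFn fun i => psi W (e i)))
  | .oracle _ _ => []

/-- The code of a placed gate, through `listNatCode`. [folklore] -/
theorem encode_gate_eq {G : QGateSet} [Encodable G.Op] (g : G.Op) (e : Fin (G.arity g) ↪ Fin N) :
    (QGate.gate g e : QGate G N).encode =
      false :: boolPair (encodeNat (Encodable.encode g)) (listNatCode (List.ofFn fun i => (e i : ℕ))) := by
  rw [QGate.encode, encodingListNatBool_encode]

/-- The code of a placed `H` of the sign basis (symbol code `0`, i.e. `ε`). [folklore] -/
theorem encode_gate_signH (E : Fin 1 ↪ Fin N) :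
    (QGate.gate (G := hSign) HSignOp.H E).encode = false :: boolPair [] (listNatCode (List.ofFn fun i : Fin 1 => (E i : ℕ))) :=
  encode_gate_eq (G := hSign) HSignOp.H E

/-- The code of a placed `CCZ` of the sign basis (symbol code `3`, i.e. `11`). [folklore] -/
theorem encode_gate_signCCZ (E : Fin 3 ↪ Fin N) :
    (QGate.gate (G := hSign) HSignOp.CCZ E).encode =
      false :: boolPair [true, true] (listNatCode (List.ofFn fun i : Fin 3 => (E i : ℕ))) :=
  encode_gate_eq (G := hSign) HSignOp.CCZ E

/-- **The code of a renumbered, translated gate.** [folklore] -/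
theorem encode_newGate (gs : List (QGate hCCSign n)) (g : QGate hCCSign n) (hg : g.IsOracleFree)
    (h : g.wires ⊆ touchedWires gs) :
    (toSignGate (mapWiresGate (kappa gs) (compressGate (touchedWires gs) g h))).encode = newCode (allWireVals gs) g := by
  rcases g with ⟨op, e⟩ | ⟨k, e⟩
  · rcases op with _ | _
    · have hw : ∀ i : Fin 1, ((((compressEmb (touchedWires gs) e fun j => h (apply_mem_wires_gate (G := hCCSign) HCCSignOp.H e j)).trans
          (kappa gs)) i : ℕ)) = psi (allWireVals gs) (e i) := fun i => by
        rw [Function.Embedding.trans_apply, kappa_apply_val]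
        exact congrArg (psi (allWireVals gs)) (congrArg Fin.val (orderEmbOfFin_rankIn (touchedWires gs) (e i) _))
      exact (encode_gate_signH _).trans
        (congrArg (fun l => false :: boolPair [] (listNatCode l)) (List.ofFn_inj.2 (funext hw)))
    · have hw : ∀ i : Fin 3, ((((compressEmb (touchedWires gs) e fun j => h (apply_mem_wires_gate (G := hCCSign) HCCSignOp.CCSIGN e j)).trans
          (kappa gs)) i : ℕ)) = psi (allWireVals gs) (e i) := fun i => by
        rw [Function.Embedding.trans_apply, kappa_apply_val]
        exact congrArg (psi (allWireVals gs)) (congrArg Fin.val (orderEmbOfFin_rankIn (touchedWires gs) (e i) _))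
      exact (encode_gate_signCCZ _).trans
        (congrArg (fun l => false :: boolPair [true, true] (listNatCode l)) (List.ofFn_inj.2 (funext hw)))
  · exact absurd hg id

/-- **The gate codes of the renumbered, translated circuit.** [folklore] -/
theorem map_encode_toSign_renumber (Q : QCircuit hCCSign n) (hQ : Q.IsOracleFree) :
    (toSign (renumber Q)).gates.map QGate.encode = Q.gates.map (newCode (allWireVals Q.gates)) := by
  change (((Q.gates.pmap (compressGate (touchedWires Q.gates)) fun _ hg => wires_subset_touchedWires hg).map
    (mapWiresGate (kappa Q.gates))).map toSignGate).map QGate.encode = _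
  rw [List.map_map, List.map_map, List.map_pmap]
  exact (List.pmap_congr_left Q.gates fun g hg h₁ _ => encode_newGate Q.gates g (hQ g hg) h₁).trans
    (List.pmap_eq_map fun _ hg => wires_subset_touchedWires hg)

/-- **The code of the new instance.** [folklore] -/
theorem encode_newInstance (Q : QCircuit hCCSign n) (hQ : Q.IsOracleFree) :
    QSimSignInstance.encode ⟨_, toSign (renumber Q)⟩ =
      boolPair (unaryEncodeNat (allWireVals Q.gates).length) (encList (Q.gates.map (newCode (allWireVals Q.gates)))) := by
  rw [QSimSignInstance.encode, encode_eq_encList, map_encode_toSign_renumber Q hQ]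

/-! ### The reduction computes the new instance -/

/-- The wire-list field of a gate code is the coded list of its wire numerals. [folklore] -/
theorem wiresOfCode_encode {G : QGateSet} [Encodable G.Op] (g : QGate G n) :
    wiresOfCode g.encode = encList ((wireVals g).map encodeNat) := by
  rcases g with ⟨op, e⟩ | ⟨k, e⟩ <;>
  · rw [QGate.encode, encodingListNatBool_encode]
    simp [wiresOfCode, sndPow, listNatCode, wireVals]

/-- **`allWiresFn` on the code of an instance**: the coded list of all wire numerals. [folklore] -/
theorem allWiresFn_encode (I : QSimInstance) :
    allWiresFn I.encode = encList ((allWireVals I.circuit.gates).map encodeNat) := by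
  rw [QSimInstance.encode, encode_eq_encList, allWiresFn_boolPair, decNil_encList, List.map_map, allWireVals,
    List.map_flatMap, encList_flatMap]
  refine congrArg List.flatten (List.map_congr_left fun g _ => ?_)
  simp only [Function.comp_apply]
  exact wiresOfCode_encode g

/-- `psiFn` on a numeral and the coded wire list is the `ψ`-numeral. [folklore] -/
theorem psiFn_encodeNat (W : List ℕ) (v : ℕ) :
    psiFn (boolPair (encodeNat v) (encList (W.map encodeNat))) = encodeNat (psi W v) := by
  rw [psiFn_boolPair, decNil_encList, List.countP_map, psi]
  congr 2
  funext u
  simp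

/-- **`newGateFn` on the code of an oracle-free gate is the code of the new gate.**
[cite: AaronsonAmbainis2018, §6 Thm. 25] -/
theorem newGateFn_encode (W : List ℕ) (g : QGate hCCSign n) (hg : g.IsOracleFree) :
    newGateFn (boolPair (encList (W.map encodeNat)) g.encode) = newCode W g := by
  rcases g with ⟨_ | _, e⟩ | ⟨k, e⟩
  · have hc : QGate.encode (QGate.gate (G := hCCSign) (n := n) HCCSignOp.H e) =
        false :: boolPair [] (listNatCode [(hPlacement e 0 : ℕ)]) := by
      rw [QGate.encode, encodingListNatBool_encode]; rfl
    have hs : symOf (boolPair (encList (W.map encodeNat)) (false :: boolPair [] (listNatCode [(hPlacement e 0 : ℕ)]))) = [] := by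
      simp [symOf, tailCode]
    rw [hc, newGateFn, Function.comp_apply, fanoutFn_apply, fanoutFn_apply, newWires_apply, if_pos hs, Function.comp_apply,
      hs, symFn_apply, if_pos rfl]
    simp only [oneWire, psiAt, arityOf, wiresOf, tailCode, fanoutFn_apply, Function.comp_apply, sndF_boolPair,
      List.tail_cons, nthF_succ_boolPair, nthF_zero_boolPair, fstF_boolPair, sndPow_succ_boolPair, sndPow_zero,
      listNatCode, List.map_cons, List.map_nil, encList_cons, encList_nil, List.length_singleton, psiFn_encodeNat]
    rfl
  · have hc : QGate.encode (QGate.gate (G := hCCSign) (n := n) HCCSignOp.CCSIGN e) =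
        false :: boolPair [true] (listNatCode [(ccsignPlacement e 0 : ℕ), (ccsignPlacement e 1 : ℕ), (ccsignPlacement e 2 : ℕ)]) := by
      rw [QGate.encode, encodingListNatBool_encode]; rfl
    have hs : symOf (boolPair (encList (W.map encodeNat))
        (false :: boolPair [true] (listNatCode [(ccsignPlacement e 0 : ℕ), (ccsignPlacement e 1 : ℕ), (ccsignPlacement e 2 : ℕ)]))) = [true] := by
      simp [symOf, tailCode]
    rw [hc, newGateFn, Function.comp_apply, fanoutFn_apply, fanoutFn_apply, newWires_apply, if_neg (by rw [hs]; simp),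
      Function.comp_apply, hs, symFn_apply, if_neg (by simp)]
    simp only [threeWires, psiAt, arityOf, wiresOf, tailCode, fanoutFn_apply, Function.comp_apply, sndF_boolPair,
      List.tail_cons, nthF_succ_boolPair, nthF_zero_boolPair, fstF_boolPair, sndPow_succ_boolPair, sndPow_zero,
      listNatCode, List.map_cons, List.map_nil, encList_cons, encList_nil, psiFn_encodeNat]
    rfl
  · exact absurd hg id

/-- **The reduction computes the code of the new instance** (oracle-free instances).
[cite: AaronsonAmbainis2018, §6 Thm. 25 ("polynomial-time reducible")] -/
theorem redFn_encode (I : QSimInstance) (hI : I.circuit.IsOracleFree) :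
    redFn I.encode = QSimSignInstance.encode ⟨_, toSign (renumber I.circuit)⟩ := by
  have hW := allWiresFn_encode I
  have hmap : (I.circuit.gates.map QGate.encode).map
      (fun c => newGateFn (boolPair (encList ((allWireVals I.circuit.gates).map encodeNat)) c)) =
      I.circuit.gates.map (newCode (allWireVals I.circuit.gates)) := by
    rw [List.map_map]
    refine List.map_congr_left fun g hg => ?_
    simp only [Function.comp_apply]
    exact newGateFn_encode (allWireVals I.circuit.gates) g (hI g hg)
  rw [encode_newInstance _ hI]
  rw [QSimInstance.encode] at hW ⊢
  rw [redFn_boolPair, hW, countFn_boolPair, decNil_encList, List.length_map, newBodyFn_boolPair,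
    ← Thm25Lex.unaryEncodeNat_eq_replicate, encode_eq_encList, decNil_encList, hmap]

/-! ### The reductions -/

/-- The new instance of an instance of QSIM. [cite: AaronsonAmbainis2018, §6 Thm. 25] -/
def newInstance (I : QSimInstance) : QSimSignInstance := ⟨_, toSign (renumber I.circuit)⟩

/-- The new instance has the same amplitude. [cite: AaronsonAmbainis2018, §6 (A_Q)] -/
theorem amplitude_newInstance (I : QSimInstance) : (newInstance I).amplitude = I.amplitude := by
  change signAmplitude (toSign (renumber I.circuit)) = transitionAmplitude I.circuit
  rw [signAmplitude_toSign, transitionAmplitude_renumber]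

/-- Yes-instances go to yes-instances. [cite: AaronsonAmbainis2018, §6 Thm. 25] -/
theorem isYes_newInstance {I : QSimInstance} (h : I.IsYes) : (newInstance I).IsYes :=
  ⟨isOracleFree_toSign (isOracleFree_renumber h.1), by rw [amplitude_newInstance]; exact h.2⟩

/-- No-instances go to no-instances. [cite: AaronsonAmbainis2018, §6 Thm. 25] -/
theorem isNo_newInstance {I : QSimInstance} (h : I.IsNo) : (newInstance I).IsNo :=
  ⟨isOracleFree_toSign (isOracleFree_renumber h.1), by rw [amplitude_newInstance]; exact h.2⟩

end Thm25Red

open Thm25Red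

/-- **QSIM over `{H, CCSIGN}` (with `n` in binary) Karp-reduces in polynomial time to QSIM over the
sign basis `{H, Z, CZ, CCZ}` (with `n` in unary)**: renumber the touched wires (`ψ`), rename
`CCSIGN` to `CCZ`; computed on codes by `Thm25Red.redFn ∈ FP`.
[cite: AaronsonAmbainis2018, §6 (p. 26: "{H, Toffoli} … equivalent … to {H, CCSIGN}"; Thm. 25)] -/
theorem qSimProblem_reducible_qSimSignProblem : PromiseProblem.PolyTimeReducible qSimProblem qSimSignProblem := by
  refine ⟨redFn, redFn_mem_FP, ?_, ?_⟩
  · rintro w ⟨I, hI, rfl⟩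
    change redFn I.encode ∈ qSimSignProblem.yes
    rw [redFn_encode I hI.1]
    exact (encode_mem_qSimSignProblem_yes_iff (newInstance I)).2 (isYes_newInstance hI)
  · rintro w ⟨I, hI, rfl⟩
    change redFn I.encode ∈ qSimSignProblem.no
    rw [redFn_encode I hI.1]
    exact (encode_mem_qSimSignProblem_no_iff (newInstance I)).2 (isNo_newInstance hI)

/-- **DISCHARGE of `AaronsonAmbainis2018_thm25` (Aaronson–Ambainis, Theorem 25: the reduction).**
QSIM over `{H, CCSIGN}` Karp-reduces in polynomial time to explicit `k`-fold FORRELATION: through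
QSIM over the sign basis (`qSimProblem_reducible_qSimSignProblem`), the discharged Theorem 25 over
that basis (`AaronsonAmbainis2018_thm25_sign_holds`: gadget `(H^{⊗2}·CSIGN)³ = SWAP`, parity
repair, gate-by-gate transcription in `FP`), and transitivity of Karp reductions of promise
problems (`PolyTimeReducible.trans_holds`). [cite: AaronsonAmbainis2018, §6 Thm. 25 (p. 27)] -/
theorem AaronsonAmbainis2018_thm25_holds : AaronsonAmbainis2018_thm25 :=
  PromiseProblem.PolyTimeReducible.trans_holds qSimProblem_reducible_qSimSignProblem
    AaronsonAmbainis2018_thm25_sign_holds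

/-- **The completeness fact from the two remaining named facts** (membership of explicit `k`-fold
FORRELATION in `PromiseBQP`, p. 26 via Prop. 6; `PromiseBQP`-hardness of QSIM over `{H, CCSIGN}`,
Lemma 24 after Shi): Theorem 25 is now proved. [cite: AaronsonAmbainis2018, §6 (Prop. 6, Lemma 24, Thm. 25)] -/
theorem aaronson_ambainis_kForrelation_complete_of_mem_of_lemma24
    (hmem : AaronsonAmbainis2018_kForrelation_mem) (h24 : AaronsonAmbainis2018_lemma24_hard) :
    aaronson_ambainis_kForrelation_complete :=
  aaronson_ambainis_kForrelation_complete_of_steps hmem h24 AaronsonAmbainis2018_thm25_holds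
    PromiseProblem.PolyTimeReducible.trans_holds

end Literature.Computability.QuantumComplexity

end
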